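import Mathlib

/-!
# Goldstone flux bound — the closing arithmetic (stub `stub_goldstoneFluxBound`)

Pure analysis serving the line `Sketch` (infimum descent) of the crux
`SpectralDefectExtinction.ChiralDescent` (item `stmt-QuantumFields-17527`).

If a real family `2 μ C(x)` indexed by the exterior `{x : ℤ⁴ // R < ‖x‖_∞}` of a sup-norm box has
(unconditional) sum `F`, and the correlator clusters as `|C(x)| ≤ K e^{-Δ(‖x‖_∞ - R)}` there, then
`|F| ≤ 2 μ K e^{Δ R} (1 + 8/Δ)⁴`.

Route (crude product form): every finite partial sum is bounded by
`2 μ K e^{Δ R} (∑_{n ∈ T} e^{-Δ|n|/4})⁴` for a finite window `T ⊂ ℤ`, using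
`e^{-Δ‖x‖_∞} ≤ ∏ᵢ e^{-Δ|xᵢ|/4}` and `Finset.prod_univ_sum`; the two-sided geometric sum satisfies
`∑_{n ∈ ℤ} e^{-c|n|} = (1 + e^{-c})/(1 - e^{-c}) ≤ 1 + 2/c` (from `c + 1 ≤ e^c`), here with
`c = Δ/4`; finally the bound passes to the limit `F` of the partial sums (`le_of_tendsto'`).
-/

namespace Summit.QuantumFields.QCD.Cruxes.ChiralDescent.InfimumDescent

open Filter Topology

/-- Two-sided geometric window bound: for `0 < c` and every finite `s ⊆ ℤ`,
`∑_{n ∈ s} e^{-c|n|} ≤ 1 + 2/c` (via `∑_{n ∈ ℤ} e^{-c|n|} = (1 + e^{-c})/(1 - e^{-c})` and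
`c + 1 ≤ e^c`). -/
private theorem sum_exp_neg_mul_abs_le {c : ℝ} (hc : 0 < c) (s : Finset ℤ) :
    ∑ n ∈ s, Real.exp (-(c * |(n : ℝ)|)) ≤ 1 + 2 / c := by
  set r : ℝ := Real.exp (-c) with hr
  have hr0 : 0 < r := Real.exp_pos _
  have hr1 : r < 1 := Real.exp_lt_one_iff.2 (by linarith)
  have hf : ∀ n : ℤ, Real.exp (-(c * |(n : ℝ)|)) = r ^ n.natAbs := by
    intro n
    rw [hr, ← Real.exp_nat_mul, Nat.cast_natAbs, Int.cast_abs]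
    congr 1
    ring
  have h1 : HasSum (fun n : ℕ => r ^ (n : ℤ).natAbs) (1 - r)⁻¹ := by
    simpa only [Int.natAbs_natCast] using hasSum_geometric_of_lt_one hr0.le hr1
  have h2 : HasSum (fun n : ℕ => r ^ (-(n + 1 : ℤ)).natAbs) (r * (1 - r)⁻¹) := by
    have hfun : (fun n : ℕ => r ^ (-(n + 1 : ℤ)).natAbs) = fun n : ℕ => r * r ^ n := by
      funext n
      rw [← pow_succ', show (-(n + 1 : ℤ)).natAbs = n + 1 by omega]
    rw [hfun]
    exact (hasSum_geometric_of_lt_one hr0.le hr1).mul_left r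
  have h : HasSum (fun n : ℤ => r ^ n.natAbs) ((1 - r)⁻¹ + r * (1 - r)⁻¹) :=
    HasSum.of_nat_of_neg_add_one h1 h2
  have key : r * (c + 1) ≤ 1 :=
    calc r * (c + 1) ≤ r * Real.exp c := mul_le_mul_of_nonneg_left (Real.add_one_le_exp c) hr0.le
      _ = 1 := by rw [hr, ← Real.exp_add, neg_add_cancel, Real.exp_zero]
  have hrc : r ≤ (1 - r) / c := by
    rw [le_div_iff₀ hc]
    linarith
  calc ∑ n ∈ s, Real.exp (-(c * |(n : ℝ)|)) = ∑ n ∈ s, r ^ n.natAbs :=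
        Finset.sum_congr rfl fun n _ => hf n
    _ ≤ ∑' n : ℤ, r ^ n.natAbs := h.summable.sum_le_tsum s fun n _ => pow_nonneg hr0.le _
    _ = (1 - r)⁻¹ + r * (1 - r)⁻¹ := h.tsum_eq
    _ = (1 + r) / (1 - r) := by rw [add_div, one_div, div_eq_mul_inv]
    _ ≤ 1 + 2 / c := by
        rw [div_le_iff₀ (sub_pos.2 hr1)]
        calc 1 + r = (1 - r) + 2 * r := by ring
          _ ≤ (1 - r) + 2 * ((1 - r) / c) := by linarith
          _ = (1 + 2 / c) * (1 - r) := by ring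

/-- Sup norm versus product weight on `ℤ⁴`: `e^{-Δ‖x‖_∞} ≤ ∏ᵢ e^{-Δ|xᵢ|/4}` for `0 ≤ Δ`
(since `4‖x‖_∞ ≥ ∑ᵢ |xᵢ|`). -/
private theorem exp_neg_mul_norm_le {Δ : ℝ} (hΔ : 0 ≤ Δ) (x : Fin 4 → ℤ) :
    Real.exp (-(Δ * ‖x‖)) ≤ ∏ i, Real.exp (-(Δ / 4 * |(x i : ℝ)|)) := by
  have hcoord : ∀ i, |(x i : ℝ)| ≤ ‖x‖ := fun i => by
    rw [← Int.norm_eq_abs]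
    exact norm_le_pi_norm x i
  have hsum4 : ∑ i, |(x i : ℝ)| ≤ 4 * ‖x‖ :=
    calc ∑ i, |(x i : ℝ)| ≤ ∑ _i : Fin 4, ‖x‖ := Finset.sum_le_sum fun i _ => hcoord i
      _ = 4 * ‖x‖ := by simp
  rw [← Real.exp_sum, Real.exp_le_exp, Finset.sum_neg_distrib, ← Finset.mul_sum, neg_le_neg_iff]
  calc Δ / 4 * ∑ i, |(x i : ℝ)| ≤ Δ / 4 * (4 * ‖x‖) := mul_le_mul_of_nonneg_left hsum4 (by positivity)
    _ = Δ * ‖x‖ := by ring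

/-- Window bound on `ℤ⁴`: for `0 < Δ` and every finite `t ⊆ ℤ⁴`,
`∑_{y ∈ t} ∏ᵢ e^{-Δ|yᵢ|/4} ≤ (1 + 8/Δ)⁴` (embed `t` in a cube `T⁴`, factorise the sum over the cube
with `Finset.prod_univ_sum`, and use the one-dimensional window bound with `c = Δ/4`). -/
private theorem sum_prod_exp_le {Δ : ℝ} (hΔ : 0 < Δ) (t : Finset (Fin 4 → ℤ)) :
    ∑ y ∈ t, ∏ i, Real.exp (-(Δ / 4 * |(y i : ℝ)|)) ≤ (1 + 8 / Δ) ^ 4 := by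
  -- a window containing every coordinate of every point of `t`
  set N : ℕ := t.sup fun y => Finset.univ.sup fun i => (y i).natAbs with hN
  have hcoord : ∀ y ∈ t, ∀ i, (y i).natAbs ≤ N := fun y hy i =>
    (Finset.le_sup (f := fun i => (y i).natAbs) (Finset.mem_univ i)).trans
      (Finset.le_sup (f := fun y : Fin 4 → ℤ => Finset.univ.sup fun i => (y i).natAbs) hy)
  set T : Finset ℤ := Finset.Icc (-(N : ℤ)) N with hT
  have hsub : t ⊆ Fintype.piFinset fun _ : Fin 4 => T := by
    intro y hy
    rw [Fintype.mem_piFinset]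
    intro i
    have h := hcoord y hy i
    rw [hT, Finset.mem_Icc]
    omega
  have hw1 : ∑ n ∈ T, Real.exp (-(Δ / 4 * |(n : ℝ)|)) ≤ 1 + 8 / Δ := by
    have h := sum_exp_neg_mul_abs_le (by positivity : 0 < Δ / 4) T
    have h8 : 2 / (Δ / 4) = 8 / Δ := by
      rw [div_div_eq_mul_div]
      ring
    linarith
  calc ∑ y ∈ t, ∏ i, Real.exp (-(Δ / 4 * |(y i : ℝ)|))
      ≤ ∑ y ∈ Fintype.piFinset (fun _ : Fin 4 => T), ∏ i, Real.exp (-(Δ / 4 * |(y i : ℝ)|)) :=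
        Finset.sum_le_sum_of_subset_of_nonneg hsub fun y _ _ =>
          Finset.prod_nonneg fun i _ => (Real.exp_pos _).le
    _ = ∏ _i : Fin 4, ∑ n ∈ T, Real.exp (-(Δ / 4 * |(n : ℝ)|)) :=
        (Finset.prod_univ_sum (fun _ : Fin 4 => T) fun _ n => Real.exp (-(Δ / 4 * |(n : ℝ)|))).symm
    _ = (∑ n ∈ T, Real.exp (-(Δ / 4 * |(n : ℝ)|))) ^ 4 := by
        rw [Finset.prod_const, Finset.card_univ, Fintype.card_fin]
    _ ≤ (1 + 8 / Δ) ^ 4 := by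
        gcongr

/-- **Goldstone flux bound** (pure analysis; the closing arithmetic of the card `goldstone-by-gauss-flux`,
crude product form). If the summed axial Ward identity outside the box of sup-radius `R` in `ℤ⁴` reads
`F = Σ_{‖x‖ > R} 2 μ C(x)` (`HasSum` over the exterior) and the pseudoscalar correlator clusters as
`|C(x)| ≤ K e^{−Δ(‖x‖ − R)}` there (`‖·‖` the sup norm of `Fin 4 → ℤ`), then
`|F| ≤ 2 μ K e^{Δ R} (1 + 8/Δ)⁴` — from `e^{−Δ‖x‖_∞} ≤ ∏ᵢ e^{−Δ|xᵢ|/4}` and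
`Σ_{n ∈ ℤ} e^{−Δ|n|/4} ≤ 1 + 8/Δ`, applied to every finite partial sum and passed to the limit. -/
theorem stub_goldstoneFluxBound :
    ∀ (C : (Fin 4 → ℤ) → ℝ) (μ K Δ F : ℝ) (R : ℕ), 0 < μ → 0 ≤ K → 0 < Δ →
      HasSum (fun x : {x : Fin 4 → ℤ // (R : ℝ) < ‖x‖} => 2 * μ * C x.1) F →
      (∀ x : Fin 4 → ℤ, (R : ℝ) < ‖x‖ → |C x| ≤ K * Real.exp (-(Δ * (‖x‖ - R)))) →
      |F| ≤ 2 * μ * K * Real.exp (Δ * R) * (1 + 8 / Δ) ^ 4 := by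
  intro C μ K Δ F R hμ hK hΔ hF hC
  -- (i)+(ii): pointwise bound on the exterior of the box
  have hpt : ∀ x : Fin 4 → ℤ, (R : ℝ) < ‖x‖ →
      |2 * μ * C x| ≤ 2 * μ * K * Real.exp (Δ * R) * ∏ i, Real.exp (-(Δ / 4 * |(x i : ℝ)|)) := by
    intro x hx
    have h2 : Real.exp (-(Δ * (‖x‖ - R))) = Real.exp (Δ * R) * Real.exp (-(Δ * ‖x‖)) := by
      rw [← Real.exp_add]
      congr 1
      ring
    calc |2 * μ * C x| = 2 * μ * |C x| := by
          rw [abs_mul, abs_of_pos (by positivity : (0 : ℝ) < 2 * μ)]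
      _ ≤ 2 * μ * (K * Real.exp (-(Δ * (‖x‖ - R)))) :=
          mul_le_mul_of_nonneg_left (hC x hx) (by positivity)
      _ = 2 * μ * K * Real.exp (Δ * R) * Real.exp (-(Δ * ‖x‖)) := by
          rw [h2]
          ring
      _ ≤ 2 * μ * K * Real.exp (Δ * R) * ∏ i, Real.exp (-(Δ / 4 * |(x i : ℝ)|)) :=
          mul_le_mul_of_nonneg_left (exp_neg_mul_norm_le hΔ.le x) (by positivity)
  -- (iii)+(iv): every finite partial sum is bounded by the constant
  have hfin : ∀ s : Finset {x : Fin 4 → ℤ // (R : ℝ) < ‖x‖},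
      |∑ x ∈ s, 2 * μ * C x.1| ≤ 2 * μ * K * Real.exp (Δ * R) * (1 + 8 / Δ) ^ 4 := by
    intro s
    calc |∑ x ∈ s, 2 * μ * C x.1| ≤ ∑ x ∈ s, |2 * μ * C x.1| := Finset.abs_sum_le_sum_abs _ _
      _ ≤ ∑ x ∈ s, 2 * μ * K * Real.exp (Δ * R) * ∏ i, Real.exp (-(Δ / 4 * |(x.1 i : ℝ)|)) :=
          Finset.sum_le_sum fun x _ => hpt x.1 x.2
      _ = 2 * μ * K * Real.exp (Δ * R) *
            ∑ y ∈ s.map (Function.Embedding.subtype _), ∏ i, Real.exp (-(Δ / 4 * |(y i : ℝ)|)) := by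
          rw [Finset.sum_map, Finset.mul_sum]
          rfl
      _ ≤ 2 * μ * K * Real.exp (Δ * R) * (1 + 8 / Δ) ^ 4 :=
          mul_le_mul_of_nonneg_left (sum_prod_exp_le hΔ _) (by positivity)
  -- (v): pass to the limit along the net of finite partial sums
  have hF' : Tendsto (fun s : Finset {x : Fin 4 → ℤ // (R : ℝ) < ‖x‖} => ∑ x ∈ s, 2 * μ * C x.1)
      atTop (𝓝 F) := hF
  have hlim : Tendsto (fun s : Finset {x : Fin 4 → ℤ // (R : ℝ) < ‖x‖} => |∑ x ∈ s, 2 * μ * C x.1|)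
      atTop (𝓝 |F|) :=
    (continuous_abs.tendsto F).comp hF'
  exact le_of_tendsto' hlim hfin

end Summit.QuantumFields.QCD.Cruxes.ChiralDescent.InfimumDescent
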